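import Summits.BirchSwinnertonDyer.BirchSwinnertonDyer.Theorems.GenusKolyvaginAtTwoK4NegTwinBsdRoadNonPhantomTwoAdicIff
import Summits.BirchSwinnertonDyer.BirchSwinnertonDyer.Theorems.GenusKolyvaginAtTwoKramerParityBridgeLocal
import Summits.BirchSwinnertonDyer.BirchSwinnertonDyer.Theorems.AdditiveKolyvaginRoadLagrangianSwitchAtPLines
import Summits.BirchSwinnertonDyer.BirchSwinnertonDyer.Theorems.SchneiderFreeAdditiveX3PoitouTateReciprocitySumHolds
import Summits.BirchSwinnertonDyer.BirchSwinnertonDyer.Theorems.GenusKolyvaginAtTwoGenusPrimitiveSupplyAtTwoTwistingPrimeLevelFourClass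
import Summits.BirchSwinnertonDyer.Rank1Residual.GaloisImage.PropagatedConditionCardEP
import Summits.BirchSwinnertonDyer.Rank1Residual.GaloisImage.PropagatedConditionCount
import Summits.BirchSwinnertonDyer.Rank1Residual.X11b.BDPRouteRelaxationExact
import Literature.NumberTheory.EllipticCurves.WeilPairingProofs
import Literature.NumberTheory.EllipticCurves.CasselsTateLemma615
import HarnessLib

/-!
# Route `GenusKolyvaginAtTwo`, K₄⁻ kernel `K4Neg` (stmt-BirchSwinnertonDyer-31526), LINE 34 «twin_bsd_road⁻» v1.4 (F4″ⁿˢˢ, T_C) —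
# THE POITOU–TATE DICHOTOMY AT `T = {2}` FOR THE LAWSON–WUTHRICH PHANTOM: off the cut with `Δ < 0` the class `ξ_E` lies in
# `Sel₂^{rel 2}(E)`; a 2-adically FULL `Sel₂(E)` swallows it (`ξ_E ∈ Sel₂(E)`, `(NPh_K)` FALSE at every frame); a 2-adically STRICT
# `Sel₂(E)` reduces `(NPh_K)` to `res₂ ξ_E ≠ 0`; and for `E(ℚ₂)[2] = 0` these are the only two cases

Width seat `bsd-line-gk2-p4` g33 (cell `bsd-f1-sign2`), WIDTH-5 attach on route `GenusKolyvaginAtTwo` rev 59; director rulings (642)(2)/(644)(b)/(657)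
(the one GK2 width seat on the K₄⁻ `2`-adic bit).  `--supports stmt-BirchSwinnertonDyer-31526 --as helper`.  THEOREMS ONLY (no definition, no named
fact, no `sorry`); standard axioms.  **BSD is NOT proved by this file; `K4Neg` is NOT proved; no item is closed by it.**

WHY.  g32 of this lineage proved (`…K4NegTwinBsdRoadNonPhantomTwoAdicIff`) that OFF THE CUT the engine hypothesis `(NPh_K)` of LINE 34 (v1.3 F4″,
v1.4 F4″ⁿˢˢ) is ONE `2`-adic bit of `E` («the Lawson–Wuthrich class `ξ_E ∈ H¹(ℚ, E[2])` — the non-zero class dying on `Γ_{ℚ(E[4])}` — is NOT a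
Kummer class at `ℚ₂`») and recorded, as a memo only, the Poitou–Tate reading of that bit; the pen's v1.4 T_C (`def PhantomSelmerClassAtTwo_T`) asserts
that on the good-supersingular off-cut habitat `ξ_E` IS a `2`-Selmer class.  This file makes the Poitou–Tate reading KERNEL THEOREMS, for EVERY
reduction type at `2`:
* §1 (any number field, any prime power `n`, any place `v₀`; the Poitou–Tate facts are the TREE THEOREMS `poitouTate_selmerStructure_duality_real_holds`,
  `forall_localEulerPoincareCharacteristic_adicCompletion`, `exists_weilPairing_holds`) ★ `mem_selmerGroup_of_mem_kummerOutside_of_full` — **THE ONE-PLACE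
  POITOU–TATE CRITERION: a class with E's Kummer condition at every place `≠ v₀` IS a Selmer class as soon as `loc_{v₀}(Sel_n(E)) ⊇ 𝓛_{v₀}`**
  (the `v₀`-relaxed image is isotropic — `X11b.Relaxation` reciprocity — and `𝓛_{v₀}` is its own annihilator — `GenusKolyKramer`).
* §2 (`ℚ`, `n = 2`, OFF THE CUT, `Δ < 0`) `mem_kummerOutside_two_of_offCut_of_Δ_neg` — **every phantom lies in `Sel₂^{rel 2}(E)`** (g32 finite silence +
  `H¹(ℝ, E) = 0`, gk2-p3 `ArchVanishing`).
* §3 ★★ `mem_selmerGroup_of_phantom_of_twoAdicallyFull` — **2-adically FULL `Sel₂(E)` (`loc_{v₂} Sel₂(E) ⊇ 𝓛₂`) ⟹ every phantom is a `2`-SELMER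
  CLASS**; `exists_phantomSelmerClass_of_twoAdicallyFull` — the conclusion of the pen's T_C VERBATIM on that sub-cell (any reduction type at `2`).
* §4 ★★ `not_nonPhantomAtTwo_of_twoAdicallyFull` — **`(NPh_K)` (F4″ / F4″ⁿˢˢ conclusion shape, Kummer asked only at `w ∋ 2`) is FALSE at EVERY `2`-split
  Heegner frame of such a curve** (g32's iff).
* §5 `nonPhantom_pow_iff_forall_localization_ne_zero_of_twoAdicallyStrict` — **2-adically STRICT `Sel₂(E)` ⟹ [`(NPh_K)` ⟺ every non-zero phantom has
  `res_{v₂} ≠ 0`]** (§2 only, no Poitou–Tate).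
* §6 `E(ℚ₂)[2] = 0` ⟹ `#𝓛₂ = 2` ⟹ STRICT ∨ FULL; ★★★ `nonPhantom_pow_iff_strict_and_forall_localization_ne_zero` — **F4″⁻ at a `2`-split Heegner frame
  ⟺ «`Sel₂(E) ⊂ ker loc_{v₂}` AND `res_{v₂} ξ_E ≠ 0`»**, the exact per-curve bit of director (653)(2)/(657).
READING (census; nothing closed): T_C at `a₂ = ±2` (pen: `res₂ φ₂ ≠ 0`) ⟺ «`Sel₂(E)` not 2-adically strict»; F4″ⁿˢˢ is refuted for every off-cut K₄⁻
curve whose `Ш(E)[2]` is 2-adically full, and on 2-adically strict curves it is the finite-group question `res_{D₂} ξ_E ≠ 0`.  BSD is NOT proved.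

References: [MilneADT2006] I Cor. 2.3, Thm. 2.8, Rem. 3.7, Thm. 4.10 (b), Lemma 6.15; [MazurRubin2010] Def. 3.1, Lemma 3.2; [PoonenRains2012] Prop. 4.10,
4.11; [LawsonWuthrich2016] §3 Thm. 1, §7.1, §8; [GrossLMS1991] §6, §9; [Howard2004HeegnerKolyvagin] Thm. 2.1.11.
-/

set_option autoImplicit false
set_option linter.dupNamespace false -- `Summit.<P>.<Sub>` repeats `BirchSwinnertonDyer` (D-0017)

noncomputable section

open scoped Classical NumberField ContRepresentation

namespace Summit.BirchSwinnertonDyer.BirchSwinnertonDyer.Theorems.GenusExact.Lw2PhantomExclusion.TwoAdic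

open WeierstrassCurve Field NumberField IsDedekindDomain Function Rat.HeightOneSpectrum
open Literature.NumberTheory.EllipticCurves Literature.NumberTheory.GaloisRepresentations
open Literature.NumberTheory.GaloisRepresentations.DiscreteGaloisModule (SelmerStructure)
open Literature.NumberTheory.GaloisCohomology
open Summit.BirchSwinnertonDyer.Rank1Residual.X11b.FiniteDuality
open Summit.BirchSwinnertonDyer.Rank1Residual.X11b.Relaxation
open Summit.BirchSwinnertonDyer.Rank1Residual.X11b.KummerPT (kummerRelaxed kummerRelaxed_of_mem kummerRelaxed_of_not_mem
  selmerGroup_kummerRelaxed)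
open Summit.BirchSwinnertonDyer.BirchSwinnertonDyer.Theorems.SchneiderFreeAdditiveX3.PoitouTateReduction
  (poitouTate_selmerStructure_duality_real_holds)
open Summit.BirchSwinnertonDyer.Rank1Residual.GaloisImage.EP (forall_localEulerPoincareCharacteristic_adicCompletion)
open Summit.BirchSwinnertonDyer.Rank1Residual.GaloisImage (natCard_quot_adicCompletionIntegers_of_prime_mem)
open Summit.BirchSwinnertonDyer.BirchSwinnertonDyer.Theorems.GenusExact.VisiblePairAtTwo (natCast_prime_mem_iff_eq)
open Summit.BirchSwinnertonDyer.BirchSwinnertonDyer.Theorems.GenusExact.ArchVanishing (mem_selmerLocalKer_infinitePlace_of_Δ_neg)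
open Summit.BirchSwinnertonDyer.BirchSwinnertonDyer.Theorems.GenusKolyTwistingPrime (exists_ne_zero_forall_torsionFixing_four_h1Eval_eq_zero)

/-! ## §1 The one-place Poitou–Tate criterion (any number field, any prime power, any place; facts discharged) -/

section OnePlace

variable {K : Type} [Field K] [NumberField K] (W : WeierstrassCurve K) [W.IsElliptic] (n : ℕ) [NeZero n]

/-- ★ **THE ONE-PLACE POITOU–TATE CRITERION (local form).**  `E = W` elliptic over a number field `K`, `n` a prime power, `v₀` ANY place of
`K` (finite or infinite).  If `x ∈ H¹(K, E[n])` satisfies E's Kummer condition at every place `≠ v₀` (`x ∈ kummerOutside W n {v₀} =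
H¹_{𝓚, ⊤ at v₀}`) and the Selmer group is FULL at `v₀` — every element of the local Kummer group `𝓛_{v₀}` is `loc_{v₀}` of some Selmer class —
then `loc_{v₀} x ∈ 𝓛_{v₀}`: `inv_{v₀}(loc s ∪ₑ loc x) = 0` for every Selmer class `s` (Poitou–Tate reciprocity, the other local terms vanish by
isotropy), so `loc x` annihilates `𝓛_{v₀}`, which is its OWN annihilator (local duality at every place).  The Poitou–Tate family, the local Euler
characteristic and the Weil pairing are tree THEOREMS: nothing is assumed. [cite: MilneADT2006, Ch. I, Cor. 2.3, Thm. 2.8, Rem. 3.7 and Thm. 4.10 (b)]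
[cite: PoonenRains2012, Prop. 4.10 and Prop. 4.11] [cite: MazurRubin2010, Lemma 3.2] -/
theorem localization_mem_kummerSelmerStructure_of_mem_kummerOutside_of_full (hn : IsPrimePow n) (v₀ : Place K)
    {x : galoisCohomology (W.torsionGaloisModule (n : ℤ)) 1} (hx : x ∈ kummerOutside W n {v₀})
    (hfull : ∀ ℓ ∈ W.kummerSelmerStructure (n : ℤ) v₀, ∃ s ∈ W.selmerGroup (n : ℤ),
      galoisCohomology.localization (W.torsionGaloisModule (n : ℤ)) v₀ 1 s = ℓ) :
    galoisCohomology.localization (W.torsionGaloisModule (n : ℤ)) v₀ 1 x ∈ W.kummerSelmerStructure (n : ℤ) v₀ := by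
  haveI : PerfectField K := PerfectField.ofCharZero
  -- cup products need the compactness of the local absolute Galois groups; `E[n]` is finite
  haveI : ∀ v : Place K, CompactSpace (absoluteGaloisGroup (Place.Completion v)) := fun v ↦ absoluteGaloisGroup_compactSpace _
  haveI : Finite (geomTorsion W n) := finite_geomTorsion_of_neZero W n
  have hn2 : 2 ≤ n := by
    obtain ⟨p, k, hp, hk, rfl⟩ := (isPrimePow_nat_iff n).mp hn
    exact hp.two_le.trans (Nat.le_self_pow hk.ne' p)
  -- the three discharged facts: a Poitou–Tate family (real places included), Tate's local Euler characteristic, a Weil pairing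
  obtain ⟨inv, hperf, hvan, -, -, hreal⟩ := poitouTate_selmerStructure_duality_real_holds K n
  have hEP := forall_localEulerPoincareCharacteristic_adicCompletion K
  obtain ⟨e, hμ, hadd₁, hadd₂, halt, hnondeg, hgal⟩ :=
    exists_weilPairing_holds W n hn2 (Nat.cast_ne_zero.mpr (NeZero.ne n))
  -- `𝓛_{v₀}` is its own right annihilator
  rw [← GenusKolyKramer.annRight_invWeilPairing_kummerSelmerStructure_eq W n e hμ hadd₁ hadd₂ hgal halt hnondeg inv hn
    hperf hEP hreal v₀, mem_annRight_iff]
  intro ℓ hℓ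
  obtain ⟨s, hs, rfl⟩ := hfull ℓ hℓ
  -- reciprocity: `⟨loc x, loc s⟩_{v₀} = 0`, and the pairing is symmetric
  rw [AdditiveKoly.LagrangianSwitchAtP.invWeilPairing_symm W n e hμ hadd₁ hadd₂ hgal halt inv v₀]
  exact invWeilPairing_localization_eq_zero_of_mem_selmerGroup W n e hμ hadd₁ hadd₂ hgal halt inv hvan v₀ hx hs

/-- ★ **THE ONE-PLACE POITOU–TATE CRITERION (global form): `H¹_{𝓚, ⊤ at v₀}(K, E[n]) = Sel_n(E/K)` as soon as `loc_{v₀}(Sel_n(E/K)) ⊇ 𝓛_{v₀}`.**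
A class with E's Kummer condition at every place other than `v₀` is a Selmer class if the Selmer group is full at `v₀`.  Any number field, any
prime power `n`, any place `v₀`; facts discharged (§1).  [cite: MilneADT2006, Ch. I, Thm. 4.10 (b) and Lemma 6.15] [cite: MazurRubin2010, Lemma 3.2] -/
theorem mem_selmerGroup_of_mem_kummerOutside_of_full (hn : IsPrimePow n) (v₀ : Place K)
    {x : galoisCohomology (W.torsionGaloisModule (n : ℤ)) 1} (hx : x ∈ kummerOutside W n {v₀})
    (hfull : ∀ ℓ ∈ W.kummerSelmerStructure (n : ℤ) v₀, ∃ s ∈ W.selmerGroup (n : ℤ),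
      galoisCohomology.localization (W.torsionGaloisModule (n : ℤ)) v₀ 1 s = ℓ) :
    x ∈ W.selmerGroup (n : ℤ) := by
  refine mem_selmerGroup_of_mem_kummerOutside W n hx fun v ↦ ?_
  obtain ⟨v, hv⟩ := v
  have hv' : v = v₀ := Finset.mem_singleton.mp hv
  subst hv'
  exact localization_mem_kummerSelmerStructure_of_mem_kummerOutside_of_full W n hn v hx hfull

end OnePlace

/-! ## §2 Off the cut with `Δ < 0`, every level-`2` phantom lies in `Sel₂^{rel 2}(E)` -/

section Rat

variable (W : WeierstrassCurve ℚ) [W.IsElliptic] [W.IsGloballyMinimal] [NeZero (W.conductorNorm ℤ)]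

/-- **Off the cut, `Δ < 0`: a class of `H¹(ℚ, E[2])` dying on `Γ_{ℚ(E[4])}` has E's Kummer condition at EVERY place other than a place `v₂ ∋ 2`**
(`x ∈ kummerOutside W 2 {v₂} = Sel₂^{rel 2}(E)`).  Finite `v ≠ v₂`: g32's silence lemma `mem_selmerLocalKer_rat_of_offCut_of_ne_two` (good
primes: unramified; odd `ℓ ∣ N`: additive with `c_ℓ` odd, `H¹(ℚ_ℓ, E[2]) = 0`).  The real place: `H¹(ℝ, E) = 0` for `Δ < 0` (gk2-p3
`ArchVanishing.mem_selmerLocalKer_infinitePlace_of_Δ_neg`).  [cite: GrossLMS1991, §6 (proof of Prop. 6.2 (1)) and §7 (7.1), (7.4)]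
[cite: MilneADT2006, Ch. I, Rem. 3.7 and Lemma 6.15] -/
theorem mem_kummerOutside_two_of_offCut_of_Δ_neg (hT : Odd W.tamagawaProduct)
    (hoff : ¬ ∃ v : HeightOneSpectrum (𝓞 ℚ), ((2 : ℕ) : 𝓞 ℚ) ∉ v.asIdeal ∧ ((W.conductorNorm ℤ : ℕ) : 𝓞 ℚ) ∈ v.asIdeal ∧
      W.HasMultiplicativeReductionAt v)
    (hneg : W.Δ < 0) (v₂ : HeightOneSpectrum (𝓞 ℚ)) (hv₂ : ((2 : ℕ) : 𝓞 ℚ) ∈ v₂.asIdeal)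
    {x : galH1Torsion W ((2 : ℕ) : ℤ)} (hx : ∀ ρ ∈ torsionFixing W (4 : ℤ), h1Eval W ((2 : ℕ) : ℤ) x ρ = 0) :
    x ∈ kummerOutside W 2 {(Sum.inr v₂ : Place ℚ)} := by
  refine (mem_kummerOutside_iff W 2 _ x).mpr fun v hv ↦ ?_
  -- membership in the local condition at `v` = membership in `selmerLocalKer` at the completion
  suffices h : x ∈ selmerLocalKer W (Place.Completion v) ((2 : ℕ) : ℤ) by
    exact AddSubgroup.mem_comap.mp ((SetLike.ext_iff.mp (W.comap_localization_kummerSelmerStructure ((2 : ℕ) : ℤ) v) x).mpr h)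
  rcases v with w | v
  · -- the real place: `H¹(ℝ, E) = 0` for `Δ < 0`
    exact mem_selmerLocalKer_infinitePlace_of_Δ_neg W w hneg ((2 : ℕ) : ℤ) x
  · -- a finite place `v ≠ v₂`, so `2 ∉ v`
    have h2v : ((2 : ℕ) : 𝓞 ℚ) ∉ v.asIdeal := by
      intro h2
      have h₁ : v = primesEquiv.symm ⟨2, Nat.prime_two⟩ := (natCast_prime_mem_iff_eq Nat.prime_two v).mp h2
      have h₂ : v₂ = primesEquiv.symm ⟨2, Nat.prime_two⟩ := (natCast_prime_mem_iff_eq Nat.prime_two v₂).mp hv₂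
      exact hv (Finset.mem_singleton.mpr (by rw [h₁, h₂]))
    exact mem_selmerLocalKer_rat_of_offCut_of_ne_two W hT hoff v h2v hx

/-- **Off the cut, `Δ < 0`: such a phantom IS a `2`-Selmer class iff it is a Kummer class at `v₂`** (all other places are silent, §2).
[cite: GrossLMS1991, §6 and §7] [cite: MilneADT2006, Ch. I, Lemma 6.15] -/
theorem mem_selmerGroup_iff_mem_selmerLocalKer_two_of_offCut_of_Δ_neg (hT : Odd W.tamagawaProduct)
    (hoff : ¬ ∃ v : HeightOneSpectrum (𝓞 ℚ), ((2 : ℕ) : 𝓞 ℚ) ∉ v.asIdeal ∧ ((W.conductorNorm ℤ : ℕ) : 𝓞 ℚ) ∈ v.asIdeal ∧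
      W.HasMultiplicativeReductionAt v)
    (hneg : W.Δ < 0) (v₂ : HeightOneSpectrum (𝓞 ℚ)) (hv₂ : ((2 : ℕ) : 𝓞 ℚ) ∈ v₂.asIdeal)
    {x : galH1Torsion W ((2 : ℕ) : ℤ)} (hx : ∀ ρ ∈ torsionFixing W (4 : ℤ), h1Eval W ((2 : ℕ) : ℤ) x ρ = 0) :
    x ∈ W.selmerGroup ((2 : ℕ) : ℤ) ↔ x ∈ selmerLocalKer W (v₂.adicCompletion ℚ) ((2 : ℕ) : ℤ) := by
  constructor
  · intro h
    exact ((W.mem_selmerGroup_iff _ x).mp h).1 v₂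
  · intro h
    refine mem_selmerGroup_of_mem_kummerOutside W 2 (mem_kummerOutside_two_of_offCut_of_Δ_neg W hT hoff hneg v₂ hv₂ hx) fun v ↦ ?_
    obtain ⟨v, hv⟩ := v
    have hv' : v = Sum.inr v₂ := Finset.mem_singleton.mp hv
    subst hv'
    have h' : x ∈ selmerLocalKer W (Place.Completion (Sum.inr v₂ : Place ℚ)) ((2 : ℕ) : ℤ) := h
    exact AddSubgroup.mem_comap.mp
      ((SetLike.ext_iff.mp (W.comap_localization_kummerSelmerStructure ((2 : ℕ) : ℤ) (Sum.inr v₂)) x).mpr h')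

/-! ## §3 ★★ A 2-adically FULL Selmer group swallows the phantom: `ξ_E ∈ Sel₂(E)` -/

/-- ★★ **OFF THE CUT, `Δ < 0`, `Sel₂(E)` 2-ADICALLY FULL ⟹ EVERY CLASS OF `H¹(ℚ, E[2])` DYING ON `Γ_{ℚ(E[4])}` IS A `2`-SELMER CLASS.**
`E = W/ℚ` globally minimal elliptic with `C(E)` odd, no odd multiplicative prime, `Δ_E < 0`; `v₂` the place over `2`; FULLNESS: every element of
the local Kummer group `𝓛₂ = im(E(ℚ₂)/2 → H¹(ℚ₂, E[2]))` is the localisation of a `2`-Selmer class of `E` (e.g. `E(ℚ₂)[2] = 0` and ONE Selmer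
class with `res_{v₂} ≠ 0`, §6).  Then `ξ_E ∈ Sel₂(E)` for every phantom `ξ_E` — ANY reduction type at `2`.  (§2: `ξ_E ∈ Sel₂^{rel 2}`; §1: the
one-place Poitou–Tate criterion.)  This is the conclusion of the pen's T_C `PhantomSelmerClassAtTwo_T` on the 2-adically-full sub-cell, with the
fullness in place of «good supersingular at 2».  BSD is NOT proved by this. [cite: MilneADT2006, Ch. I, Thm. 4.10 (b), Cor. 2.3, Thm. 2.8]
[cite: MazurRubin2010, Lemma 3.2] [cite: LawsonWuthrich2016, §7.1, §8] -/
theorem mem_selmerGroup_of_phantom_of_twoAdicallyFull (hT : Odd W.tamagawaProduct)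
    (hoff : ¬ ∃ v : HeightOneSpectrum (𝓞 ℚ), ((2 : ℕ) : 𝓞 ℚ) ∉ v.asIdeal ∧ ((W.conductorNorm ℤ : ℕ) : 𝓞 ℚ) ∈ v.asIdeal ∧
      W.HasMultiplicativeReductionAt v)
    (hneg : W.Δ < 0) (v₂ : HeightOneSpectrum (𝓞 ℚ)) (hv₂ : ((2 : ℕ) : 𝓞 ℚ) ∈ v₂.asIdeal)
    (hfull : ∀ ℓ ∈ W.kummerSelmerStructure ((2 : ℕ) : ℤ) (Sum.inr v₂), ∃ s ∈ W.selmerGroup ((2 : ℕ) : ℤ),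
      galoisCohomology.localization (W.torsionGaloisModule ((2 : ℕ) : ℤ)) (Sum.inr v₂) 1 s = ℓ)
    {x : galH1Torsion W ((2 : ℕ) : ℤ)} (hx : ∀ ρ ∈ torsionFixing W (4 : ℤ), h1Eval W ((2 : ℕ) : ℤ) x ρ = 0) :
    x ∈ W.selmerGroup ((2 : ℕ) : ℤ) :=
  mem_selmerGroup_of_mem_kummerOutside_of_full W 2 Nat.prime_two.isPrimePow (Sum.inr v₂)
    (mem_kummerOutside_two_of_offCut_of_Δ_neg W hT hoff hneg v₂ hv₂ hx) hfull

/-- ★★ **THE PHANTOM SELMER CLASS on the 2-adically-full sub-cell — the pen's T_C `PhantomSelmerClassAtTwo_T`, conclusion VERBATIM**: off the cut,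
`Δ < 0`, `C(E)` odd, `ρ_{E,4}` onto, `Sel₂(E)` 2-adically full ⟹ there is a NON-ZERO `z ∈ H¹(ℚ, E[2])` dying on `Γ_{ℚ(E[4])}` and lying in the
Selmer local condition at EVERY finite place.  Existence of `z ≠ 0` = the tree's Lawson–Wuthrich level-`4` class
(`GenusKolyTwistingPrime.exists_ne_zero_forall_torsionFixing_four_h1Eval_eq_zero`); its Selmer-ness = §3.  No `¬CM`, no reduction-type hypothesis
at `2`.  BSD is NOT proved by this. [cite: LawsonWuthrich2016, §3 Thm. 1, §7.1, §8] [cite: MilneADT2006, Ch. I, Thm. 4.10 (b)] -/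
theorem exists_phantomSelmerClass_of_twoAdicallyFull (hT : Odd W.tamagawaProduct)
    (hoff : ¬ ∃ v : HeightOneSpectrum (𝓞 ℚ), ((2 : ℕ) : 𝓞 ℚ) ∉ v.asIdeal ∧ ((W.conductorNorm ℤ : ℕ) : 𝓞 ℚ) ∈ v.asIdeal ∧
      W.HasMultiplicativeReductionAt v)
    (hneg : W.Δ < 0) (hρ4 : W.HasSurjectiveModNGaloisRep ((2 : ℤ) ^ 2))
    (v₂ : HeightOneSpectrum (𝓞 ℚ)) (hv₂ : ((2 : ℕ) : 𝓞 ℚ) ∈ v₂.asIdeal)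
    (hfull : ∀ ℓ ∈ W.kummerSelmerStructure ((2 : ℕ) : ℤ) (Sum.inr v₂), ∃ s ∈ W.selmerGroup ((2 : ℕ) : ℤ),
      galoisCohomology.localization (W.torsionGaloisModule ((2 : ℕ) : ℤ)) (Sum.inr v₂) 1 s = ℓ) :
    ∃ z : galH1Torsion W ((2 : ℕ) : ℤ), z ≠ 0 ∧
      (∀ ρ' ∈ torsionFixing W ((4 : ℕ) : ℤ), h1Eval W ((2 : ℕ) : ℤ) z ρ' = 0) ∧
      (∀ v : HeightOneSpectrum (𝓞 ℚ), z ∈ selmerLocalKer W (v.adicCompletion ℚ) ((2 : ℕ) : ℤ)) := by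
  have hs4 : W.HasSurjectiveModNGaloisRep (4 : ℤ) := by norm_num at hρ4; exact hρ4
  obtain ⟨z, hz0, hz⟩ := exists_ne_zero_forall_torsionFixing_four_h1Eval_eq_zero W hs4
  refine ⟨z, hz0, fun ρ' hρ' ↦ hz ρ' hρ', fun v ↦ ?_⟩
  exact ((W.mem_selmerGroup_iff _ z).mp (mem_selmerGroup_of_phantom_of_twoAdicallyFull W hT hoff hneg v₂ hv₂ hfull hz)).1 v

/-! ## §4 ★★ `(NPh_K)` is FALSE at every `2`-split Heegner frame of a 2-adically full curve -/

/-- ★★ **F4″ / F4″ⁿˢˢ REFUTED ON THE 2-ADICALLY-FULL SUB-CELL.**  `E = W/ℚ` globally minimal elliptic, `C(E)` odd, no odd multiplicative prime,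
`Δ_E < 0`, `ρ_{E,2^n}` onto for every `n ≥ 1`, and `Sel₂(E)` 2-adically FULL (every element of `𝓛₂` is `loc_{v₂}` of a Selmer class).  Then at EVERY
frame `K` of LINE 34 (`K` imaginary quadratic, `d_K` odd, `d_K·(−|Δ|)`, `d_K·(−2|Δ|)` non-squares, Heegner for `N_E`, `2` SPLIT) the statement
«for every `L ≥ 1`, every class of `H¹(K, E[2^L])` dying on `Γ_{K(E[2^L])}` that is a Kummer class at the places `w ∋ 2` is `0`» — the conclusion
of LINE 34's `stub_offCutNonPhantomAtTwo_nonSS` (and of v1.3's F4″) — is FALSE.  Proof: the Lawson–Wuthrich class `ξ_E ≠ 0` is a `2`-Selmer class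
(§3), so it is Kummer at `v₂`, contradicting g32's `E`-intrinsic criterion `nonPhantom_pow_iff_forall_not_mem_selmerLocalKer_two_of_offCut`.  No
reduction-type hypothesis at `2`.  BSD is NOT proved by this; `K4Neg` is neither proved nor refuted (F4″ⁿˢˢ is a STUB of one line, not the crux).
[cite: LawsonWuthrich2016, §3, §7.1, §8] [cite: MilneADT2006, Ch. I, Thm. 4.10 (b)] [cite: GrossLMS1991, §9] -/
theorem not_nonPhantomAtTwo_of_twoAdicallyFull {K : Type} [Field K] [NumberField K]
    (hρ : ∀ n : ℕ, 0 < n → W.HasSurjectiveModNGaloisRep ((2 : ℤ) ^ n)) (hT : Odd W.tamagawaProduct)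
    (hoff : ¬ ∃ v : HeightOneSpectrum (𝓞 ℚ), ((2 : ℕ) : 𝓞 ℚ) ∉ v.asIdeal ∧ ((W.conductorNorm ℤ : ℕ) : 𝓞 ℚ) ∈ v.asIdeal ∧
      W.HasMultiplicativeReductionAt v)
    (hneg : W.Δ < 0) (v₂ : HeightOneSpectrum (𝓞 ℚ)) (hv₂ : ((2 : ℕ) : 𝓞 ℚ) ∈ v₂.asIdeal)
    (hfull : ∀ ℓ ∈ W.kummerSelmerStructure ((2 : ℕ) : ℤ) (Sum.inr v₂), ∃ s ∈ W.selmerGroup ((2 : ℕ) : ℤ),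
      galoisCohomology.localization (W.torsionGaloisModule ((2 : ℕ) : ℤ)) (Sum.inr v₂) 1 s = ℓ)
    (hK : IsImaginaryQuadratic K) (hodd : Odd (NumberField.discr K)) (hnsq₁ : ¬ IsSquare ((NumberField.discr K : ℚ) * -|W.Δ|))
    (hnsq₂ : ¬ IsSquare ((NumberField.discr K : ℚ) * (-(2 * |W.Δ|))))
    (hH : SatisfiesHeegnerHypothesis (W.conductorNorm ℤ) K) (h2K : ((Ideal.span {(2 : ℤ)}).primesOver (𝓞 K)).ncard = 2) :
    ¬ ∀ (L : ℕ), 1 ≤ L → ∀ z : galH1Torsion (W.baseChange K) ((2 ^ L : ℕ) : ℤ),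
      (∀ ρ' ∈ torsionFixing (W.baseChange K) ((2 ^ L : ℕ) : ℤ), h1Eval (W.baseChange K) ((2 ^ L : ℕ) : ℤ) z ρ' = 0) →
      (∀ w : HeightOneSpectrum (𝓞 K), ((2 : ℕ) : 𝓞 K) ∈ w.asIdeal →
        z ∈ selmerLocalKer (W.baseChange K) (w.adicCompletion K) ((2 ^ L : ℕ) : ℤ)) → z = 0 := by
  intro hN
  -- the «Kummer at `w ∋ 2N`» form follows from the «Kummer at `w ∋ 2`» form (`w ∋ 2 ⟹ w ∋ 2N`)
  have hN' : ∀ (Mlev : ℕ), 1 ≤ Mlev → ∀ z : galH1Torsion (W.baseChange K) ((2 ^ Mlev : ℕ) : ℤ),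
      (∀ ρ ∈ torsionFixing (W.baseChange K) ((2 ^ Mlev : ℕ) : ℤ), h1Eval (W.baseChange K) ((2 ^ Mlev : ℕ) : ℤ) z ρ = 0) →
      (∀ w : HeightOneSpectrum (𝓞 K), ((2 * W.conductorNorm ℤ : ℕ) : 𝓞 K) ∈ w.asIdeal →
        z ∈ selmerLocalKer (W.baseChange K) (w.adicCompletion K) ((2 ^ Mlev : ℕ) : ℤ)) → z = 0 := by
    intro M hM z hz hw
    refine hN M hM z hz fun w h2w ↦ hw w ?_
    rw [Nat.cast_mul]
    exact w.asIdeal.mul_mem_right _ h2w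
  have hv₂eq : v₂ = primesEquiv.symm ⟨2, Nat.prime_two⟩ := (natCast_prime_mem_iff_eq Nat.prime_two v₂).mp hv₂
  have hcrit := (nonPhantom_pow_iff_forall_not_mem_selmerLocalKer_two_of_offCut W hρ hT hoff hK hodd hnsq₁ hnsq₂ hH h2K).mp hN'
  -- but the Lawson–Wuthrich class is a Selmer class, hence Kummer at `v₂`
  obtain ⟨z, hz0, hz, hzS⟩ := exists_phantomSelmerClass_of_twoAdicallyFull W hT hoff hneg (hρ 2 two_pos) v₂ hv₂ hfull
  have hz4 : ∀ h ∈ torsionFixing W (4 : ℤ), h1Eval W (2 : ℤ) z h = 0 := fun h hh ↦ hz h (by exact_mod_cast hh)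
  refine hcrit z hz0 hz4 ?_
  rw [← hv₂eq]
  exact hzS v₂

/-! ## §5 A 2-adically STRICT Selmer group: `(NPh_K)` ⟺ `res_{v₂} ξ_E ≠ 0` -/

/-- **Off the cut, `Δ < 0`, `Sel₂(E)` 2-adically STRICT (`loc_{v₂} s = 0` for every Selmer class `s`): a phantom is a Kummer class at `v₂`
iff its localisation at `v₂` VANISHES.**  (`⟸`: `0 ∈ 𝓛₂`.  `⟹`: Kummer at `v₂` + §2 ⟹ Selmer ⟹ strict.)  No Poitou–Tate needed.
[cite: GrossLMS1991, §6 and §7] [cite: MilneADT2006, Ch. I, Lemma 6.15] -/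
theorem mem_selmerLocalKer_two_iff_localization_eq_zero_of_twoAdicallyStrict (hT : Odd W.tamagawaProduct)
    (hoff : ¬ ∃ v : HeightOneSpectrum (𝓞 ℚ), ((2 : ℕ) : 𝓞 ℚ) ∉ v.asIdeal ∧ ((W.conductorNorm ℤ : ℕ) : 𝓞 ℚ) ∈ v.asIdeal ∧
      W.HasMultiplicativeReductionAt v)
    (hneg : W.Δ < 0) (v₂ : HeightOneSpectrum (𝓞 ℚ)) (hv₂ : ((2 : ℕ) : 𝓞 ℚ) ∈ v₂.asIdeal)
    (hstrict : ∀ s ∈ W.selmerGroup ((2 : ℕ) : ℤ), galoisCohomology.localization (W.torsionGaloisModule ((2 : ℕ) : ℤ)) (Sum.inr v₂) 1 s = 0)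
    {x : galH1Torsion W ((2 : ℕ) : ℤ)} (hx : ∀ ρ ∈ torsionFixing W (4 : ℤ), h1Eval W ((2 : ℕ) : ℤ) x ρ = 0) :
    x ∈ selmerLocalKer W (v₂.adicCompletion ℚ) ((2 : ℕ) : ℤ) ↔
      galoisCohomology.localization (W.torsionGaloisModule ((2 : ℕ) : ℤ)) (Sum.inr v₂) 1 x = 0 := by
  constructor
  · intro h
    exact hstrict x ((mem_selmerGroup_iff_mem_selmerLocalKer_two_of_offCut_of_Δ_neg W hT hoff hneg v₂ hv₂ hx).mpr h)
  · intro h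
    have h' : x ∈ (W.kummerSelmerStructure ((2 : ℕ) : ℤ) (Sum.inr v₂)).comap
        (galoisCohomology.localization (W.torsionGaloisModule ((2 : ℕ) : ℤ)) (Sum.inr v₂) 1) :=
      AddSubgroup.mem_comap.mpr ((congrArg (· ∈ W.kummerSelmerStructure ((2 : ℕ) : ℤ) (Sum.inr v₂)) h).mpr (zero_mem _))
    have h'' : x ∈ selmerLocalKer W (Place.Completion (Sum.inr v₂ : Place ℚ)) ((2 : ℕ) : ℤ) :=
      (SetLike.ext_iff.mp (W.comap_localization_kummerSelmerStructure ((2 : ℕ) : ℤ) (Sum.inr v₂)) x).mp h'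
    exact h''

/-- ★ **2-ADICALLY STRICT `Sel₂(E)`: `(NPh_K)` AT A `2`-SPLIT HEEGNER FRAME ⟺ EVERY NON-ZERO PHANTOM HAS `res_{v₂} ≠ 0`** (off the cut, `Δ < 0`,
`ρ_{E,2^n}` onto; the `(NPh_M ∀ M)` form of g32's iff, Kummer asked at the places over `2N`).  The right-hand side is a property of the image
`D₂ ≤ GL₂(ℤ/4)` of the decomposition group alone (`res_{D₂}` of the generator of `H¹(GL₂(ℤ/4), 𝔽₂²) = 𝔽₂`).  BSD is NOT proved by this.
[cite: LawsonWuthrich2016, §3, §7.1, §8] [cite: GrossLMS1991, §9 Prop. 9.1] -/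
theorem nonPhantom_pow_iff_forall_localization_ne_zero_of_twoAdicallyStrict {K : Type} [Field K] [NumberField K]
    (hρ : ∀ n : ℕ, 0 < n → W.HasSurjectiveModNGaloisRep ((2 : ℤ) ^ n)) (hT : Odd W.tamagawaProduct)
    (hoff : ¬ ∃ v : HeightOneSpectrum (𝓞 ℚ), ((2 : ℕ) : 𝓞 ℚ) ∉ v.asIdeal ∧ ((W.conductorNorm ℤ : ℕ) : 𝓞 ℚ) ∈ v.asIdeal ∧
      W.HasMultiplicativeReductionAt v)
    (hneg : W.Δ < 0) (v₂ : HeightOneSpectrum (𝓞 ℚ)) (hv₂ : ((2 : ℕ) : 𝓞 ℚ) ∈ v₂.asIdeal)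
    (hstrict : ∀ s ∈ W.selmerGroup ((2 : ℕ) : ℤ), galoisCohomology.localization (W.torsionGaloisModule ((2 : ℕ) : ℤ)) (Sum.inr v₂) 1 s = 0)
    (hK : IsImaginaryQuadratic K) (hodd : Odd (NumberField.discr K)) (hnsq₁ : ¬ IsSquare ((NumberField.discr K : ℚ) * -|W.Δ|))
    (hnsq₂ : ¬ IsSquare ((NumberField.discr K : ℚ) * (-(2 * |W.Δ|))))
    (hH : SatisfiesHeegnerHypothesis (W.conductorNorm ℤ) K) (h2K : ((Ideal.span {(2 : ℤ)}).primesOver (𝓞 K)).ncard = 2) :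
    (∀ (Mlev : ℕ), 1 ≤ Mlev → ∀ z : galH1Torsion (W.baseChange K) ((2 ^ Mlev : ℕ) : ℤ),
        (∀ ρ ∈ torsionFixing (W.baseChange K) ((2 ^ Mlev : ℕ) : ℤ), h1Eval (W.baseChange K) ((2 ^ Mlev : ℕ) : ℤ) z ρ = 0) →
        (∀ w : HeightOneSpectrum (𝓞 K), ((2 * W.conductorNorm ℤ : ℕ) : 𝓞 K) ∈ w.asIdeal →
          z ∈ selmerLocalKer (W.baseChange K) (w.adicCompletion K) ((2 ^ Mlev : ℕ) : ℤ)) → z = 0) ↔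
      ∀ x : galH1Torsion W (2 : ℤ), x ≠ 0 → (∀ h ∈ torsionFixing W (4 : ℤ), h1Eval W (2 : ℤ) x h = 0) →
        galoisCohomology.localization (W.torsionGaloisModule ((2 : ℕ) : ℤ)) (Sum.inr v₂) 1 x ≠ 0 := by
  have hv₂eq : v₂ = primesEquiv.symm ⟨2, Nat.prime_two⟩ := (natCast_prime_mem_iff_eq Nat.prime_two v₂).mp hv₂
  rw [nonPhantom_pow_iff_forall_not_mem_selmerLocalKer_two_of_offCut W hρ hT hoff hK hodd hnsq₁ hnsq₂ hH h2K, ← hv₂eq]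
  refine forall_congr' fun x ↦ forall_congr' fun _ ↦ forall_congr' fun hx ↦ not_congr ?_
  exact mem_selmerLocalKer_two_iff_localization_eq_zero_of_twoAdicallyStrict W hT hoff hneg v₂ hv₂ hstrict (fun ρ hρ' ↦ hx ρ hρ')

/-! ## §6 `E(ℚ₂)[2] = 0`: the Selmer group is 2-adically STRICT or FULL, and the sharp form of the bit -/

omit [W.IsGloballyMinimal] [NeZero (W.conductorNorm ℤ)] in
/-- **`E(ℚ₂)[2] = 0` ⟹ `#𝓛₂ = 2`** (`#𝓛_v = #E(K_v)[n]·#(𝓞_v/n)`, Milne I Lemma 3.3; `#(ℤ₂/2) = 2`). [cite: MilneADT2006, Ch. I, Lemma 3.3] -/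
theorem natCard_kummerSelmerStructure_two_eq_two (v₂ : HeightOneSpectrum (𝓞 ℚ)) (hv₂ : ((2 : ℕ) : 𝓞 ℚ) ∈ v₂.asIdeal)
    (htor : Nat.card (nsmulAddMonoidHom 2 : (W.baseChange (v₂.adicCompletion ℚ)).toAffine.Point →+ _).ker = 1) :
    Nat.card (W.kummerSelmerStructure ((2 : ℕ) : ℤ) (Sum.inr v₂)) = 2 := by
  haveI : Fact (Nat.Prime 2) := ⟨Nat.prime_two⟩
  rw [W.natCard_kummerSelmerStructure_inr v₂ two_ne_zero, htor, one_mul]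
  exact natCard_quot_adicCompletionIntegers_of_prime_mem 2 hv₂

omit [W.IsGloballyMinimal] [NeZero (W.conductorNorm ℤ)] in
/-- **`E(ℚ₂)[2] = 0` ⟹ `Sel₂(E)` is 2-adically STRICT or 2-adically FULL** (its image in the two-element group `𝓛₂` is `0` or everything).
[cite: MilneADT2006, Ch. I, Lemma 3.3] -/
theorem twoAdicallyStrict_or_twoAdicallyFull_of_natCard_ker_two_eq_one (v₂ : HeightOneSpectrum (𝓞 ℚ)) (hv₂ : ((2 : ℕ) : 𝓞 ℚ) ∈ v₂.asIdeal)
    (htor : Nat.card (nsmulAddMonoidHom 2 : (W.baseChange (v₂.adicCompletion ℚ)).toAffine.Point →+ _).ker = 1) :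
    (∀ s ∈ W.selmerGroup ((2 : ℕ) : ℤ), galoisCohomology.localization (W.torsionGaloisModule ((2 : ℕ) : ℤ)) (Sum.inr v₂) 1 s = 0) ∨
      ∀ ℓ ∈ W.kummerSelmerStructure ((2 : ℕ) : ℤ) (Sum.inr v₂), ∃ s ∈ W.selmerGroup ((2 : ℕ) : ℤ),
        galoisCohomology.localization (W.torsionGaloisModule ((2 : ℕ) : ℤ)) (Sum.inr v₂) 1 s = ℓ := by
  set L := W.kummerSelmerStructure ((2 : ℕ) : ℤ) (Sum.inr v₂) with hL
  set loc := galoisCohomology.localization (W.torsionGaloisModule ((2 : ℕ) : ℤ)) (Sum.inr v₂) 1 with hloc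
  have hcard : Nat.card L = 2 := natCard_kummerSelmerStructure_two_eq_two W v₂ hv₂ htor
  by_cases hstrict : ∀ s ∈ W.selmerGroup ((2 : ℕ) : ℤ), loc s = 0
  · exact Or.inl hstrict
  · right
    push Not at hstrict
    obtain ⟨s, hs, hs0⟩ := hstrict
    have hsL : loc s ∈ L := (W.mem_selmerGroup_iff_forall_localization_mem _ s).mp hs (Sum.inr v₂)
    intro ℓ hℓ
    by_cases hℓ0 : ℓ = 0
    · exact ⟨0, zero_mem _, (map_zero loc).trans (hℓ0 ▸ rfl)⟩
    · refine ⟨s, hs, ?_⟩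
      -- two non-zero elements of a group of order `2` coincide
      obtain ⟨y, -, hy⟩ := (Nat.card_eq_two_iff' (0 : L)).mp hcard
      have h1 : (⟨ℓ, hℓ⟩ : L) = y := hy _ fun h ↦ hℓ0 (congrArg Subtype.val h)
      have h2 : (⟨loc s, hsL⟩ : L) = y := hy _ fun h ↦ hs0 (congrArg Subtype.val h)
      exact congrArg Subtype.val (h2.trans h1.symm)

/-- ★★★ **THE SHARP BIT.  Off the cut, `Δ < 0`, `ρ_{E,2^n}` onto, `E(ℚ₂)[2] = 0`: `(NPh_K)` at a `2`-split Heegner frame (the `(NPh_M ∀ M)` form,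
Kummer asked at the places over `2N`) ⟺ «`Sel₂(E)` is 2-adically STRICT AND every non-zero phantom has `res_{v₂} ≠ 0`».**  (`⟹`: were `Sel₂(E)`
full, the Lawson–Wuthrich class would be Selmer, §3/§4; so strict, §6, and then §5.  `⟸`: §5.)  This is the exact content of LINE 34's F4″ⁿˢˢ per
curve on the `E(ℚ₂)[2] = 0` sub-cell: ONE `2`-descent datum («is `Ш(E)[2]` visible at `2`?») and ONE finite-group datum (`res_{D₂}` of the generator
of `H¹(GL₂(ℤ/4), 𝔽₂²)`).  BSD is NOT proved by this; nothing is closed. [cite: LawsonWuthrich2016, §3, §7.1, §8] [cite: MilneADT2006, Ch. I, Thm. 4.10 (b),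
Lemma 3.3] [cite: MazurRubin2010, Lemma 3.2] -/
theorem nonPhantom_pow_iff_strict_and_forall_localization_ne_zero {K : Type} [Field K] [NumberField K]
    (hρ : ∀ n : ℕ, 0 < n → W.HasSurjectiveModNGaloisRep ((2 : ℤ) ^ n)) (hT : Odd W.tamagawaProduct)
    (hoff : ¬ ∃ v : HeightOneSpectrum (𝓞 ℚ), ((2 : ℕ) : 𝓞 ℚ) ∉ v.asIdeal ∧ ((W.conductorNorm ℤ : ℕ) : 𝓞 ℚ) ∈ v.asIdeal ∧
      W.HasMultiplicativeReductionAt v)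
    (hneg : W.Δ < 0) (v₂ : HeightOneSpectrum (𝓞 ℚ)) (hv₂ : ((2 : ℕ) : 𝓞 ℚ) ∈ v₂.asIdeal)
    (htor : Nat.card (nsmulAddMonoidHom 2 : (W.baseChange (v₂.adicCompletion ℚ)).toAffine.Point →+ _).ker = 1)
    (hK : IsImaginaryQuadratic K) (hodd : Odd (NumberField.discr K)) (hnsq₁ : ¬ IsSquare ((NumberField.discr K : ℚ) * -|W.Δ|))
    (hnsq₂ : ¬ IsSquare ((NumberField.discr K : ℚ) * (-(2 * |W.Δ|))))
    (hH : SatisfiesHeegnerHypothesis (W.conductorNorm ℤ) K) (h2K : ((Ideal.span {(2 : ℤ)}).primesOver (𝓞 K)).ncard = 2) :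
    (∀ (Mlev : ℕ), 1 ≤ Mlev → ∀ z : galH1Torsion (W.baseChange K) ((2 ^ Mlev : ℕ) : ℤ),
        (∀ ρ ∈ torsionFixing (W.baseChange K) ((2 ^ Mlev : ℕ) : ℤ), h1Eval (W.baseChange K) ((2 ^ Mlev : ℕ) : ℤ) z ρ = 0) →
        (∀ w : HeightOneSpectrum (𝓞 K), ((2 * W.conductorNorm ℤ : ℕ) : 𝓞 K) ∈ w.asIdeal →
          z ∈ selmerLocalKer (W.baseChange K) (w.adicCompletion K) ((2 ^ Mlev : ℕ) : ℤ)) → z = 0) ↔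
      (∀ s ∈ W.selmerGroup ((2 : ℕ) : ℤ), galoisCohomology.localization (W.torsionGaloisModule ((2 : ℕ) : ℤ)) (Sum.inr v₂) 1 s = 0) ∧
        ∀ x : galH1Torsion W (2 : ℤ), x ≠ 0 → (∀ h ∈ torsionFixing W (4 : ℤ), h1Eval W (2 : ℤ) x h = 0) →
          galoisCohomology.localization (W.torsionGaloisModule ((2 : ℕ) : ℤ)) (Sum.inr v₂) 1 x ≠ 0 := by
  have hv₂eq : v₂ = primesEquiv.symm ⟨2, Nat.prime_two⟩ := (natCast_prime_mem_iff_eq Nat.prime_two v₂).mp hv₂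
  constructor
  · intro hN
    have hstrict : ∀ s ∈ W.selmerGroup ((2 : ℕ) : ℤ),
        galoisCohomology.localization (W.torsionGaloisModule ((2 : ℕ) : ℤ)) (Sum.inr v₂) 1 s = 0 := by
      rcases twoAdicallyStrict_or_twoAdicallyFull_of_natCard_ker_two_eq_one W v₂ hv₂ htor with h | hfull
      · exact h
      · exfalso
        have hcrit := (nonPhantom_pow_iff_forall_not_mem_selmerLocalKer_two_of_offCut W hρ hT hoff hK hodd hnsq₁ hnsq₂ hH h2K).mp hN
        obtain ⟨z, hz0, hz, hzS⟩ := exists_phantomSelmerClass_of_twoAdicallyFull W hT hoff hneg (hρ 2 two_pos) v₂ hv₂ hfull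
        have hz4 : ∀ h ∈ torsionFixing W (4 : ℤ), h1Eval W (2 : ℤ) z h = 0 := fun h hh ↦ hz h (by exact_mod_cast hh)
        refine hcrit z hz0 hz4 ?_
        rw [← hv₂eq]
        exact hzS v₂
    exact ⟨hstrict, (nonPhantom_pow_iff_forall_localization_ne_zero_of_twoAdicallyStrict W hρ hT hoff hneg v₂ hv₂ hstrict hK hodd
      hnsq₁ hnsq₂ hH h2K).mp hN⟩
  · rintro ⟨hstrict, hres⟩
    exact (nonPhantom_pow_iff_forall_localization_ne_zero_of_twoAdicallyStrict W hρ hT hoff hneg v₂ hv₂ hstrict hK hodd hnsq₁ hnsq₂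
      hH h2K).mpr hres

end Rat

end Summit.BirchSwinnertonDyer.BirchSwinnertonDyer.Theorems.GenusExact.Lw2PhantomExclusion.TwoAdic

end
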